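import Mathlib
import Literature.MeasureTheory.Group.InvariantQuotientTransport
import HarnessLib

/-!
# Transport of invariant measures and of `Lᵖ(G ⧸ H)` along a group isomorphism

Topic `MeasureTheory/Group`; namespace `Literature.MeasureTheory.Group`. Small definitions with
bodies (`cosetCongrMeasurableEquiv`, `cosetPullback`, `lpCongr`, `lpCosetCongr`) and theorems; the
only instances are the measure-typeclass instances of `cosetPullback`; no named fact.

This file complements `InvariantQuotientTransport` (which transports the NORMALISED quotient
measure `ν/ρ` of Deitmar–Echterhoff, Thm. 1.5.3, along `e : G ≃* G'` with `e⁻¹(H') = H`) by the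
purely formal part of the transport of the homogeneous-space set-up `(G ⧸ H, μ, Lᵖ(G ⧸ H, μ))`
that does not depend on which invariant measure is chosen:

* `cosetCongrMeasurableEquiv` — `cosetCongr e` as a Borel measurable equivalence; the translation
  `x ↦ g⁻¹ • x` is conjugated to `y ↦ (e g)⁻¹ • y` (`inv_smul_comp_cosetCongr`);
* the push-forward of ANY `G`-invariant measure on `G ⧸ H` is `G'`-invariant
  (`smulInvariantMeasure_map_cosetCongr_of_smulInvariantMeasure`); positivity on opens and
  finiteness on compacts are preserved; dually the PULL-BACK
  `cosetPullback … μ' = μ' ∘ cosetCongr e` of a measure on `G' ⧸ H'` with its instances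
  (invariant, finite, probability, positive on opens, finite on compacts) and
  `(cosetCongr e)_* (cosetPullback μ') = μ'`;
* fundamental domains and the "restrict-and-fold" measures correspond:
  `isFundamentalDomain_image_mulEquiv` (`e(𝓕)` is a fundamental domain for `H'ᵒᵖ` and `e_* ν`),
  `map_cosetCongr_map_mk_restrict` (`(cosetCongr e)_* π_*(ν|𝓕) = π'_*((e_*ν)|e(𝓕))`) and
  `cosetPullback_map_mk_restrict`;
* `lpCongr E p 𝕜 f hf : Lp E p ν ≃ₗᵢ[𝕜] Lp E p μ`, `g ↦ g ∘ f`, for a measure-preserving measurable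
  equivalence `f : X ≃ᵐ Y` (the two-sided version of Mathlib's one-sided isometry
  `Lp.compMeasurePreservingₗᵢ`), with the INTERTWINING CRITERION `lpCongr_intertwines`: operators
  acting a.e. by composition with maps `φ_Y`, `φ_X` such that `φ_Y ∘ f = f ∘ φ_X` are intertwined;
* `lpCosetCongr … μ' : Lp E p μ' ≃ₗᵢ[𝕜] Lp E p (cosetPullback … μ')` and `lpCosetCongr_translate`:
  **`Lᵖ`-transport along `cosetCongr e` intertwines the quasi-regular representations** of `G'` on
  `Lᵖ(G' ⧸ H', μ')` and of `G` on `Lᵖ(G ⧸ H, μ' ∘ cosetCongr e)`, in whatever packaging (the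
  hypotheses only ask that the operators act a.e. as `g ↦ g((e c)⁻¹ • ·)`, resp. `h ↦ h(c⁻¹ • ·)`).

Everything here is standard transport of structure; the file exists so that two models of
`L²(Γ\G)` built over isomorphic realisations of one adelic group (a subgroup of `GL_n(𝔸_L)` and
an abstract copy of it, say) can be identified by name, with the group actions matching.
The objects (quasi-regular representation, invariant measures on `G ⧸ H`) are those of
[DeitmarEchterhoff2014, §1.5 and §9.1]; no statement of this file is specific to a reference.

NOT here: the normalised quotient measure and its naturality (`InvariantQuotientTransport`),
uniqueness of invariant measures (`InvariantQuotientUniqueness`), Haar measures on the groups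
themselves (Mathlib `ContinuousMulEquiv.isHaarMeasure_map`).
-/

noncomputable section

open _root_.MeasureTheory _root_.MeasureTheory.Measure _root_.Topology Set Function
open scoped ENNReal NNReal Pointwise

attribute [-instance] Quotient.instMeasurableSpace QuotientGroup.measurableSpace

namespace Literature.MeasureTheory.Group

/-! ## 1. Complements on `cosetCongr` -/

section Algebra

variable {G G' : Type*} [Group G] [Group G'] (e : G ≃* G') (H : Subgroup G) (H' : Subgroup G')
  (hHH' : ∀ g, e g ∈ H' ↔ g ∈ H)

/-- The underlying function of `cosetCongrEquiv` is `cosetCongr` (definitional). [folklore] -/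
@[simp]
theorem coe_cosetCongrEquiv : ⇑(cosetCongrEquiv e H H' hHH') = cosetCongr e H H' hHH' := rfl

/-- The inverse of `cosetCongrEquiv e` is `cosetCongrEquiv e.symm` (definitional). [folklore] -/
theorem cosetCongrEquiv_symm :
    (cosetCongrEquiv e H H' hHH').symm =
      cosetCongrEquiv e.symm H' H (forall_symm_mem_iff e H H' hHH') :=
  rfl

/-- The underlying function of the inverse of `cosetCongrEquiv e` (definitional). [folklore] -/
@[simp]
theorem coe_cosetCongrEquiv_symm :
    ⇑(cosetCongrEquiv e H H' hHH').symm =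
      cosetCongr e.symm H' H (forall_symm_mem_iff e H H' hHH') :=
  rfl

/-- `cosetCongr e ∘ π = π' ∘ e` (definitional). [folklore] -/
theorem cosetCongr_comp_mk :
    cosetCongr e H H' hHH' ∘ (QuotientGroup.mk : G → G ⧸ H) = QuotientGroup.mk ∘ e := rfl

/-- `cosetCongr e` conjugates the translation `x ↦ g⁻¹ • x` of `G ⧸ H` to the translation
`y ↦ (e g)⁻¹ • y` of `G' ⧸ H'`. [folklore] -/
theorem inv_smul_comp_cosetCongr (g : G) :
    (fun y : G' ⧸ H' => (e g)⁻¹ • y) ∘ cosetCongr e H H' hHH' =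
      cosetCongr e H H' hHH' ∘ fun x : G ⧸ H => g⁻¹ • x := by
  funext x
  simp only [comp_apply, cosetCongr_smul, map_inv]

/-- `cosetCongr e` conjugates the translation by `c` to the translation by `e c`. [folklore] -/
theorem smul_comp_cosetCongr (c : G) :
    (fun y : G' ⧸ H' => e c • y) ∘ cosetCongr e H H' hHH' =
      cosetCongr e H H' hHH' ∘ fun x : G ⧸ H => c • x := by
  funext x
  simp only [comp_apply, cosetCongr_smul]

end Algebra

/-! ## 2. `cosetCongr` as a measurable equivalence; transport of measures on `G ⧸ H` -/

section Measure

variable {G G' : Type*} [Group G] [Group G'] [TopologicalSpace G] [TopologicalSpace G']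
  (e : G ≃* G') (H : Subgroup G) (H' : Subgroup G') (hHH' : ∀ g, e g ∈ H' ↔ g ∈ H)
  (he : Continuous e) (hes : Continuous e.symm)

/-- The inverse homeomorphism is `cosetCongr e.symm` (definitional). [folklore] -/
@[simp]
theorem coe_cosetCongrHomeomorph_symm :
    ⇑(cosetCongrHomeomorph e H H' hHH' he hes).symm =
      cosetCongr e.symm H' H (forall_symm_mem_iff e H H' hHH') := rfl

variable [MeasurableSpace (G ⧸ H)] [BorelSpace (G ⧸ H)] [MeasurableSpace (G' ⧸ H')]
  [BorelSpace (G' ⧸ H')]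

include he in
/-- `cosetCongr e` is Borel measurable when `e` is continuous. [folklore] -/
theorem measurable_cosetCongr : Measurable (cosetCongr e H H' hHH') :=
  (continuous_cosetCongr e H H' hHH' he).measurable

/-- **`cosetCongr e` as a measurable equivalence `G ⧸ H ≃ᵐ G' ⧸ H'`** of the Borel σ-algebras, for
a homeomorphic group isomorphism `e`. [folklore] -/
def cosetCongrMeasurableEquiv : G ⧸ H ≃ᵐ G' ⧸ H' :=
  (cosetCongrHomeomorph e H H' hHH' he hes).toMeasurableEquiv

/-- The underlying map of `cosetCongrMeasurableEquiv` (definitional). [folklore] -/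
@[simp]
theorem coe_cosetCongrMeasurableEquiv :
    ⇑(cosetCongrMeasurableEquiv e H H' hHH' he hes) = cosetCongr e H H' hHH' := rfl

/-- The underlying map of the inverse of `cosetCongrMeasurableEquiv` (definitional). [folklore] -/
@[simp]
theorem coe_cosetCongrMeasurableEquiv_symm :
    ⇑(cosetCongrMeasurableEquiv e H H' hHH' he hes).symm =
      cosetCongr e.symm H' H (forall_symm_mem_iff e H H' hHH') := rfl

include he in
/-- **The push-forward of a `G`-invariant measure on `G ⧸ H` along `cosetCongr e` is
`G'`-invariant** (for an arbitrary invariant measure; `smulInvariantMeasure_map_cosetCongr` of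
`InvariantQuotientTransport` is the case of the normalised quotient measure). [folklore] -/
theorem smulInvariantMeasure_map_cosetCongr_of_smulInvariantMeasure [IsTopologicalGroup G']
    (μ : Measure (G ⧸ H)) [SMulInvariantMeasure G (G ⧸ H) μ] :
    SMulInvariantMeasure G' (G' ⧸ H') (μ.map (cosetCongr e H H' hHH')) := by
  refine ⟨fun c s hs => ?_⟩
  have hm := measurable_cosetCongr e H H' hHH' he
  rw [Measure.map_apply hm hs, Measure.map_apply hm (measurable_const_smul c hs), ← preimage_comp]
  have hc : (fun y : G' ⧸ H' => c • y) ∘ cosetCongr e H H' hHH' =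
      cosetCongr e H H' hHH' ∘ fun x => e.symm c • x := by
    rw [← smul_comp_cosetCongr e H H' hHH' (e.symm c), MulEquiv.apply_symm_apply]
  rw [hc, preimage_comp]
  exact SMulInvariantMeasure.measure_preimage_smul (e.symm c) (hm hs)

include he hes in
/-- Positivity on open sets passes to the push-forward along `cosetCongr e`. [folklore] -/
theorem isOpenPosMeasure_map_cosetCongr (μ : Measure (G ⧸ H)) [μ.IsOpenPosMeasure] :
    (μ.map (cosetCongr e H H' hHH')).IsOpenPosMeasure :=
  (cosetCongrHomeomorph e H H' hHH' he hes).continuous.isOpenPosMeasure_map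
    (cosetCongrHomeomorph e H H' hHH' he hes).surjective

include he hes in
/-- Finiteness on compact sets passes to the push-forward along `cosetCongr e`. [folklore] -/
theorem isFiniteMeasureOnCompacts_map_cosetCongr (μ : Measure (G ⧸ H))
    [IsFiniteMeasureOnCompacts μ] : IsFiniteMeasureOnCompacts (μ.map (cosetCongr e H H' hHH')) := by
  rw [← coe_cosetCongrHomeomorph e H H' hHH' he hes]
  exact IsFiniteMeasureOnCompacts.map μ _

include he in
/-- `cosetCongr e` is measure preserving from `μ` to `(cosetCongr e)_* μ`. [folklore] -/
theorem measurePreserving_cosetCongr_map (μ : Measure (G ⧸ H)) :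
    MeasurePreserving (cosetCongr e H H' hHH') μ (μ.map (cosetCongr e H H' hHH')) :=
  ⟨measurable_cosetCongr e H H' hHH' he, rfl⟩

/-- **The pull-back `μ' ∘ cosetCongr e`** of a measure `μ'` on `G' ⧸ H'` to `G ⧸ H`: the
push-forward of `μ'` along the inverse `cosetCongr e.symm`. [folklore] -/
def cosetPullback (μ' : Measure (G' ⧸ H')) : Measure (G ⧸ H) :=
  μ'.map (cosetCongr e.symm H' H (forall_symm_mem_iff e H H' hHH'))

variable (μ' : Measure (G' ⧸ H'))

omit [TopologicalSpace G] [TopologicalSpace G'] [BorelSpace (G ⧸ H)] [BorelSpace (G' ⧸ H')] in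
/-- Unfolding `cosetPullback`. [folklore] -/
theorem cosetPullback_def :
    cosetPullback e H H' hHH' μ' =
      μ'.map (cosetCongr e.symm H' H (forall_symm_mem_iff e H H' hHH')) :=
  rfl

include he hes in
/-- `cosetCongr e` is **measure preserving from the pull-back `μ' ∘ cosetCongr e` to `μ'`**.
[folklore] -/
theorem measurePreserving_cosetCongr_cosetPullback :
    MeasurePreserving (cosetCongr e H H' hHH') (cosetPullback e H H' hHH' μ') μ' := by
  have h := (cosetCongrMeasurableEquiv e H H' hHH' he hes).symm.measurePreserving_symm μ'
  simpa only [cosetPullback, MeasurableEquiv.symm_symm, coe_cosetCongrMeasurableEquiv,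
    coe_cosetCongrMeasurableEquiv_symm] using h

include he hes in
/-- `(cosetCongr e)_* (μ' ∘ cosetCongr e) = μ'`. [folklore] -/
theorem map_cosetCongr_cosetPullback :
    (cosetPullback e H H' hHH' μ').map (cosetCongr e H H' hHH') = μ' :=
  (measurePreserving_cosetCongr_cosetPullback e H H' hHH' he hes μ').map_eq

include hes in
/-- The pull-back on measurable sets: `(μ' ∘ cosetCongr e)(s) = μ'(cosetCongr e '' s)`.
[folklore] -/
theorem cosetPullback_apply {s : Set (G ⧸ H)} (hs : MeasurableSet s) :
    cosetPullback e H H' hHH' μ' s = μ' (cosetCongr e H H' hHH' '' s) := by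
  rw [cosetPullback, Measure.map_apply (measurable_cosetCongr e.symm H' H _ hes) hs,
    ← coe_cosetCongrEquiv_symm, ← Equiv.image_eq_preimage_symm, coe_cosetCongrEquiv]

include hes in
/-- The pull-back has the same total mass. [folklore] -/
theorem cosetPullback_univ : cosetPullback e H H' hHH' μ' univ = μ' univ := by
  rw [cosetPullback_apply e H H' hHH' hes μ' MeasurableSet.univ, ← coe_cosetCongrEquiv, image_univ,
    Equiv.range_eq_univ]

include hes in
/-- **The pull-back of a `G'`-invariant measure is `G`-invariant.** [folklore] -/
theorem smulInvariantMeasure_cosetPullback [IsTopologicalGroup G]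
    [SMulInvariantMeasure G' (G' ⧸ H') μ'] :
    SMulInvariantMeasure G (G ⧸ H) (cosetPullback e H H' hHH' μ') :=
  smulInvariantMeasure_map_cosetCongr_of_smulInvariantMeasure e.symm H' H _ hes μ'

omit [TopologicalSpace G] [TopologicalSpace G'] [BorelSpace (G ⧸ H)] [BorelSpace (G' ⧸ H')] in
/-- The pull-back of a finite measure is finite. [folklore] -/
theorem isFiniteMeasure_cosetPullback [IsFiniteMeasure μ'] :
    IsFiniteMeasure (cosetPullback e H H' hHH' μ') := by
  unfold cosetPullback; infer_instance

include hes in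
/-- The pull-back of a probability measure is a probability measure. [folklore] -/
theorem isProbabilityMeasure_cosetPullback [IsProbabilityMeasure μ'] :
    IsProbabilityMeasure (cosetPullback e H H' hHH' μ') :=
  Measure.isProbabilityMeasure_map (measurable_cosetCongr e.symm H' H _ hes).aemeasurable

include he hes in
/-- The pull-back of a measure positive on open sets is positive on open sets. [folklore] -/
theorem isOpenPosMeasure_cosetPullback [μ'.IsOpenPosMeasure] :
    (cosetPullback e H H' hHH' μ').IsOpenPosMeasure :=
  isOpenPosMeasure_map_cosetCongr e.symm H' H _ hes he μ'

include he hes in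
/-- The pull-back of a measure finite on compact sets is finite on compact sets. [folklore] -/
theorem isFiniteMeasureOnCompacts_cosetPullback [IsFiniteMeasureOnCompacts μ'] :
    IsFiniteMeasureOnCompacts (cosetPullback e H H' hHH' μ') :=
  isFiniteMeasureOnCompacts_map_cosetCongr e.symm H' H _ hes he μ'

end Measure

/-! ## 3. Fundamental domains and the folded measures `π_*(ν|𝓕)` -/

section FundamentalDomain

variable {G G' : Type*} [Group G] [Group G'] [MeasurableSpace G] [MeasurableSpace G']
  (e : G ≃* G') (hem : Measurable e) (hesm : Measurable e.symm)
  (H : Subgroup G) (H' : Subgroup G') (hHH' : ∀ g, e g ∈ H' ↔ g ∈ H)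

/-- A group isomorphism measurable in both directions, as a measurable equivalence. [folklore] -/
def _root_.MulEquiv.toMeasurableEquiv' : G ≃ᵐ G' where
  toEquiv := e.toEquiv
  measurable_toFun := hem
  measurable_invFun := hesm

/-- The underlying map of `MulEquiv.toMeasurableEquiv'` (definitional). [folklore] -/
@[simp]
theorem _root_.MulEquiv.coe_toMeasurableEquiv' : ⇑(e.toMeasurableEquiv' hem hesm) = e := rfl

include hHH' hem hesm in
/-- **A fundamental domain `𝓕` for the right action of `H` on `(G, ν)` is carried by `e` to a
fundamental domain `e(𝓕)` for the right action of `H'` on `(G', e_* ν)`.** [folklore] -/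
theorem isFundamentalDomain_image_mulEquiv {ν : Measure G} {𝓕 : Set G}
    (h𝓕 : IsFundamentalDomain H.op 𝓕 ν) : IsFundamentalDomain H'.op (e '' 𝓕) (ν.map e) := by
  -- transport along the measurable equivalence `e`, equivariant for `H'ᵒᵖ ≃ Hᵒᵖ`
  let f : H'.op ≃ H.op :=
    { toFun := fun γ => ⟨MulOpposite.op (e.symm γ.1.unop), Subgroup.mem_op.2 (by
        simpa only [MulOpposite.unop_op] using
          (forall_symm_mem_iff e H H' hHH' _).2 (Subgroup.mem_op.1 γ.2))⟩
      invFun := fun γ => ⟨MulOpposite.op (e γ.1.unop), Subgroup.mem_op.2 (by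
        simpa only [MulOpposite.unop_op] using (hHH' _).2 (Subgroup.mem_op.1 γ.2))⟩
      left_inv := fun γ => by ext; simp
      right_inv := fun γ => by ext; simp }
  have hf : Measure.QuasiMeasurePreserving (e.toMeasurableEquiv' hem hesm).symm (ν.map e) ν :=
    ((e.toMeasurableEquiv' hem hesm).measurePreserving_symm ν).quasiMeasurePreserving
  exact h𝓕.image_of_equiv (e.toMeasurableEquiv' hem hesm).toEquiv hf f (fun γ x => by
    change e (x * e.symm γ.1.unop) = e x * γ.1.unop
    rw [map_mul, MulEquiv.apply_symm_apply])

include hem hesm in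
/-- **The folded measures correspond**: `(cosetCongr e)_* (π_*(ν|𝓕)) = π'_*((e_* ν)|e(𝓕))`, for
any measurable structures on the coset spaces making the projections and `cosetCongr e`
measurable. [folklore] -/
theorem map_cosetCongr_map_mk_restrict [MeasurableSpace (G ⧸ H)] [MeasurableSpace (G' ⧸ H')]
    (hπ : Measurable (QuotientGroup.mk : G → G ⧸ H))
    (hπ' : Measurable (QuotientGroup.mk : G' → G' ⧸ H'))
    (hc : Measurable (cosetCongr e H H' hHH')) (ν : Measure G) (𝓕 : Set G) :
    ((ν.restrict 𝓕).map (QuotientGroup.mk : G → G ⧸ H)).map (cosetCongr e H H' hHH') =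
      ((ν.map e).restrict (e '' 𝓕)).map (QuotientGroup.mk : G' → G' ⧸ H') := by
  rw [Measure.map_map hc hπ, cosetCongr_comp_mk, ← Measure.map_map hπ' hem]
  congr 1
  rw [show (⇑e : G → G') = ⇑(e.toMeasurableEquiv' hem hesm) from rfl,
    MeasurableEquiv.restrict_map, MeasurableEquiv.preimage_image]

end FundamentalDomain

section FundamentalDomainBorel

variable {G G' : Type*} [Group G] [Group G'] [TopologicalSpace G] [TopologicalSpace G']
  [MeasurableSpace G] [BorelSpace G] [MeasurableSpace G'] [BorelSpace G']
  (e : G ≃* G') (H : Subgroup G) (H' : Subgroup G') (hHH' : ∀ g, e g ∈ H' ↔ g ∈ H)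
  (he : Continuous e) (hes : Continuous e.symm)
  [MeasurableSpace (G ⧸ H)] [BorelSpace (G ⧸ H)] [MeasurableSpace (G' ⧸ H')] [BorelSpace (G' ⧸ H')]

include he hes in
/-- Borel version of `map_cosetCongr_map_mk_restrict`:
`(cosetCongr e)_* (π_*(ν|𝓕)) = π'_*((e_* ν)|e(𝓕))`. [folklore] -/
theorem map_cosetCongr_map_mk_restrict_borel (ν : Measure G) (𝓕 : Set G) :
    ((ν.restrict 𝓕).map (QuotientGroup.mk : G → G ⧸ H)).map (cosetCongr e H H' hHH') =
      ((ν.map e).restrict (e '' 𝓕)).map (QuotientGroup.mk : G' → G' ⧸ H') :=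
  map_cosetCongr_map_mk_restrict e he.measurable hes.measurable H H' hHH'
    continuous_quotient_mk'.measurable continuous_quotient_mk'.measurable
    (measurable_cosetCongr e H H' hHH' he) ν 𝓕

include he hes in
/-- **The pull-back of a folded measure is the folded measure of the pulled-back data**:
`π'_*(ν'|𝓕') ∘ cosetCongr e = π_*((e⁻¹_* ν')|e⁻¹(𝓕'))`. [folklore] -/
theorem cosetPullback_map_mk_restrict (ν' : Measure G') (𝓕' : Set G') :
    cosetPullback e H H' hHH' ((ν'.restrict 𝓕').map (QuotientGroup.mk : G' → G' ⧸ H')) =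
      ((ν'.map e.symm).restrict (e ⁻¹' 𝓕')).map (QuotientGroup.mk : G → G ⧸ H) := by
  rw [cosetPullback, map_cosetCongr_map_mk_restrict_borel e.symm H' H _ hes he ν' 𝓕',
    ← MulEquiv.coe_toEquiv_symm, Equiv.image_symm_eq_preimage]
  rfl

end FundamentalDomainBorel

/-! ## 4. `Lᵖ` along a measure-preserving measurable equivalence -/

section Lp

variable {X Y : Type*} [MeasurableSpace X] [MeasurableSpace Y] {μ : Measure X} {ν : Measure Y}
  (E : Type*) [NormedAddCommGroup E] (p : ℝ≥0∞) [Fact (1 ≤ p)]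
  (𝕜 : Type*) [NormedRing 𝕜] [Module 𝕜 E] [IsBoundedSMul 𝕜 E]

/-- **`Lᵖ` transport along a measure-preserving measurable equivalence** `f : X ≃ᵐ Y` with
`f_* μ = ν`: the linear isometric ISOMORPHISM `Lp E p ν ≃ₗᵢ[𝕜] Lp E p μ`, `g ↦ g ∘ f`, with inverse
`h ↦ h ∘ f⁻¹` (the two-sided version of Mathlib's `Lp.compMeasurePreservingₗᵢ`). [folklore] -/
def lpCongr (f : X ≃ᵐ Y) (hf : MeasurePreserving f μ ν) : Lp E p ν ≃ₗᵢ[𝕜] Lp E p μ where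
  toLinearEquiv :=
    { Lp.compMeasurePreservingₗ 𝕜 (f : X → Y) hf with
      invFun := Lp.compMeasurePreserving (f.symm : Y → X) (hf.symm f)
      left_inv := fun g => by
        change Lp.compMeasurePreserving f.symm (hf.symm f) (Lp.compMeasurePreserving f hf g) = g
        rw [← Lp.compMeasurePreserving_comp_apply g hf (hf.symm f)]
        simp only [MeasurableEquiv.self_comp_symm, Lp.compMeasurePreserving_id_apply]
      right_inv := fun g => by
        change Lp.compMeasurePreserving f hf (Lp.compMeasurePreserving f.symm (hf.symm f) g) = g
        rw [← Lp.compMeasurePreserving_comp_apply g (hf.symm f) hf]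
        simp only [MeasurableEquiv.symm_comp_self, Lp.compMeasurePreserving_id_apply] }
  norm_map' g := Lp.norm_compMeasurePreserving g hf

variable {E p 𝕜}

/-- `lpCongr f` is `Lp.compMeasurePreserving f` (definitional). [folklore] -/
theorem lpCongr_apply (f : X ≃ᵐ Y) (hf : MeasurePreserving f μ ν) (g : Lp E p ν) :
    lpCongr E p 𝕜 f hf g = Lp.compMeasurePreserving f hf g := rfl

/-- The inverse of `lpCongr f` is `Lp.compMeasurePreserving f.symm` (definitional). [folklore] -/
theorem lpCongr_symm_apply (f : X ≃ᵐ Y) (hf : MeasurePreserving f μ ν) (g : Lp E p μ) :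
    (lpCongr E p 𝕜 f hf).symm g = Lp.compMeasurePreserving f.symm (hf.symm f) g := rfl

/-- `lpCongr f g = g ∘ f` almost everywhere. [folklore] -/
theorem coeFn_lpCongr (f : X ≃ᵐ Y) (hf : MeasurePreserving f μ ν) (g : Lp E p ν) :
    (lpCongr E p 𝕜 f hf g : X → E) =ᵐ[μ] (g : Y → E) ∘ f :=
  Lp.coeFn_compMeasurePreserving g hf

/-- `(lpCongr f)⁻¹ h = h ∘ f⁻¹` almost everywhere. [folklore] -/
theorem coeFn_lpCongr_symm (f : X ≃ᵐ Y) (hf : MeasurePreserving f μ ν) (h : Lp E p μ) :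
    ((lpCongr E p 𝕜 f hf).symm h : Y → E) =ᵐ[ν] (h : X → E) ∘ f.symm :=
  Lp.coeFn_compMeasurePreserving h (hf.symm f)

/-- `lpCongr f` on the class of a function `g` is the class of `g ∘ f`. [folklore] -/
theorem lpCongr_toLp (f : X ≃ᵐ Y) (hf : MeasurePreserving f μ ν) {g : Y → E} (hg : MemLp g p ν) :
    lpCongr E p 𝕜 f hf (hg.toLp g) = (hg.comp_measurePreserving hf).toLp (g ∘ f) := rfl

/-- **Intertwining criterion.** Let `A` act on `Lp E p ν` a.e. by composition with `φY : Y → Y`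
and `B` on `Lp E p μ` a.e. by composition with a quasi-measure-preserving `φX : X → X`; if
`φY ∘ f = f ∘ φX` then `lpCongr f (A g) = B (lpCongr f g)`. [folklore] -/
theorem lpCongr_intertwines (f : X ≃ᵐ Y) (hf : MeasurePreserving f μ ν)
    {A : Lp E p ν → Lp E p ν} {B : Lp E p μ → Lp E p μ} {φY : Y → Y} {φX : X → X}
    (hA : ∀ g : Lp E p ν, (A g : Y → E) =ᵐ[ν] (g : Y → E) ∘ φY)
    (hB : ∀ h : Lp E p μ, (B h : X → E) =ᵐ[μ] (h : X → E) ∘ φX)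
    (hφX : Measure.QuasiMeasurePreserving φX μ μ) (hcomm : φY ∘ f = f ∘ φX) (g : Lp E p ν) :
    lpCongr E p 𝕜 f hf (A g) = B (lpCongr E p 𝕜 f hf g) := by
  rw [Lp.ext_iff]
  have h1 : (lpCongr E p 𝕜 f hf (A g) : X → E) =ᵐ[μ] ((g : Y → E) ∘ φY) ∘ f :=
    (coeFn_lpCongr f hf (A g)).trans (hf.quasiMeasurePreserving.ae_eq_comp (hA g))
  have h2 : (B (lpCongr E p 𝕜 f hf g) : X → E) =ᵐ[μ] ((g : Y → E) ∘ f) ∘ φX :=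
    (hB _).trans (hφX.ae_eq_comp (coeFn_lpCongr f hf g))
  refine h1.trans (Filter.EventuallyEq.trans (Filter.Eventually.of_forall fun x => ?_) h2.symm)
  change g (φY (f x)) = g (f (φX x))
  rw [← comp_apply (f := φY) (g := f), hcomm, comp_apply]

end Lp

/-! ## 5. `Lᵖ(G' ⧸ H') ≃ Lᵖ(G ⧸ H)` along `cosetCongr` and the quasi-regular representations -/

section LpCoset

variable {G G' : Type*} [Group G] [Group G'] [TopologicalSpace G] [TopologicalSpace G']
  (e : G ≃* G') (H : Subgroup G) (H' : Subgroup G') (hHH' : ∀ g, e g ∈ H' ↔ g ∈ H)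
  (he : Continuous e) (hes : Continuous e.symm)
  [MeasurableSpace (G ⧸ H)] [BorelSpace (G ⧸ H)] [MeasurableSpace (G' ⧸ H')] [BorelSpace (G' ⧸ H')]
  (E : Type*) [NormedAddCommGroup E] (p : ℝ≥0∞) [Fact (1 ≤ p)]
  (𝕜 : Type*) [NormedRing 𝕜] [Module 𝕜 E] [IsBoundedSMul 𝕜 E]
  (μ' : Measure (G' ⧸ H'))

/-- **`Lᵖ(G' ⧸ H', μ') ≃ₗᵢ Lᵖ(G ⧸ H, μ' ∘ cosetCongr e)`**, `g ↦ g ∘ cosetCongr e`. [folklore] -/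
def lpCosetCongr : Lp E p μ' ≃ₗᵢ[𝕜] Lp E p (cosetPullback e H H' hHH' μ') :=
  lpCongr E p 𝕜 (cosetCongrMeasurableEquiv e H H' hHH' he hes)
    (measurePreserving_cosetCongr_cosetPullback e H H' hHH' he hes μ')

variable {E p 𝕜 μ'}

/-- `lpCosetCongr g = g ∘ cosetCongr e` almost everywhere. [folklore] -/
theorem coeFn_lpCosetCongr (g : Lp E p μ') :
    (lpCosetCongr e H H' hHH' he hes E p 𝕜 μ' g : G ⧸ H → E) =ᵐ[cosetPullback e H H' hHH' μ']
      (g : G' ⧸ H' → E) ∘ cosetCongr e H H' hHH' :=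
  coeFn_lpCongr _ _ g

/-- `lpCosetCongr⁻¹ h = h ∘ cosetCongr e⁻¹` almost everywhere. [folklore] -/
theorem coeFn_lpCosetCongr_symm (h : Lp E p (cosetPullback e H H' hHH' μ')) :
    ((lpCosetCongr e H H' hHH' he hes E p 𝕜 μ').symm h : G' ⧸ H' → E) =ᵐ[μ']
      (h : G ⧸ H → E) ∘ cosetCongr e.symm H' H (forall_symm_mem_iff e H H' hHH') :=
  coeFn_lpCongr_symm _ _ h

/-- `lpCosetCongr` preserves norms. [folklore] -/
theorem norm_lpCosetCongr (g : Lp E p μ') : ‖lpCosetCongr e H H' hHH' he hes E p 𝕜 μ' g‖ = ‖g‖ :=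
  (lpCosetCongr e H H' hHH' he hes E p 𝕜 μ').norm_map g

/-- **`Lᵖ`-transport along `cosetCongr e` intertwines the quasi-regular representations.** If `A`
acts on `Lᵖ(G' ⧸ H', μ')` a.e. as `g ↦ g((e c)⁻¹ • ·)` and `B` on `Lᵖ(G ⧸ H, μ' ∘ cosetCongr e)`
a.e. as `h ↦ h(c⁻¹ • ·)` — the translation operators at `e c` and at `c`, in whatever packaging —
then `lpCosetCongr (A g) = B (lpCosetCongr g)`. [folklore] -/
theorem lpCosetCongr_translate [IsTopologicalGroup G] [SMulInvariantMeasure G' (G' ⧸ H') μ']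
    (c : G) {A : Lp E p μ' → Lp E p μ'}
    {B : Lp E p (cosetPullback e H H' hHH' μ') → Lp E p (cosetPullback e H H' hHH' μ')}
    (hA : ∀ g : Lp E p μ', (A g : G' ⧸ H' → E) =ᵐ[μ'] (g : G' ⧸ H' → E) ∘ fun y => (e c)⁻¹ • y)
    (hB : ∀ h : Lp E p (cosetPullback e H H' hHH' μ'),
      (B h : G ⧸ H → E) =ᵐ[cosetPullback e H H' hHH' μ'] (h : G ⧸ H → E) ∘ fun x => c⁻¹ • x)
    (g : Lp E p μ') :
    lpCosetCongr e H H' hHH' he hes E p 𝕜 μ' (A g) =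
      B (lpCosetCongr e H H' hHH' he hes E p 𝕜 μ' g) :=
  haveI := smulInvariantMeasure_cosetPullback e H H' hHH' hes μ'
  lpCongr_intertwines _ _ hA hB
    (measurePreserving_smul c⁻¹ (cosetPullback e H H' hHH' μ')).quasiMeasurePreserving
    (inv_smul_comp_cosetCongr e H H' hHH' c) g

end LpCoset

end Literature.MeasureTheory.Group

end
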